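import Summits.QuantumAdvantage.QuantumAdvantage.Theses.LinnikCubicClassGroups
import Literature.Computability.QuantumComplexity.CWrapAssembly
import Literature.Computability.Cryptography.QubitRegisterCliffordTProofs
import Literature.Computability.Complexity.AdaptiveBPPSimulation
import Literature.Computability.Complexity.HashBricks

/-!
# QuantumAdvantage / LinnikCubicClassGroups — `BitwiseSearchToDecision` (stmt-QuantumAdvantage-12110)

Bitwise search-to-decision under the collapse `BQP ⊆ BPP` (folklore; Aaronson 2010, §1 (FBQP);
Bernstein–Vazirani 1997, §8; Arora–Barak 2009, §7.4.1 / "`BPP^BPP = BPP`"):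
if `f : {0,1}* → {0,1}*` has EXACTLY polynomial output length `|f x| = p(|x|)` and `f ∈ FBQP`,
then under `BQP ⊆ BPP` some probabilistic polynomial-time algorithm outputs `f x` with probability
`≥ 2/3` on every `x`.

Proof (entirely inside the tree's toolkit, no machine and no circuit is written here):

* *the bit language* `L_f = {⟨x, u⟩ | bit |u| of f x is 1}` (index in unary = the LENGTH of the
  second component; default `0` past the end) is in `BQP`: wrap the `FBQP` family of `f` with the
  `FP` pre-processor `⟨x, u⟩ ↦ x` and the `FP` post-processor
  `⟨⟨x, u⟩, y⟩ ↦ [((y ↾ p|x|) ⇂ |u|)₀]` (`isQSolvable_classicalWrap_holds`, Bernstein–Vazirani 1997,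
  §8); since `f x <+: y` and `|f x| = p(|x|)`, `y ↾ p(|x|) = f x`, so the wrapped family writes the
  wanted bit on wire `0` with probability `≥ 2/3`, i.e. decides `L_f` (`mem_BQP_of_isQSolvable_bit`);
* `BQP ⊆ BPP` puts `L_f` in `BPP`;
* *search from decision*: `f x` is the answer string of the (non-adaptive) oracle transducer
  asking `⟨x, answers so far⟩` — the `i`-th query has a second component of length `i` — for
  `p(|x|)` rounds (`AdQuery.adBits id L_f x (p|x|) = f x`), so the tree's pseudo-deterministic
  simulation of bounded adaptive reductions to a `BPP` language (`exists_randAlg_adFn`,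
  Arora–Barak 2009, §7.4.1 with Thm. 7.10: amplify and union-bound) is a PPT algorithm producing
  `f x` with probability `≥ 3/4 ≥ 2/3`.
-/

set_option linter.dupNamespace false -- D-0017: single-problem summit ⇒ `QuantumAdvantage.QuantumAdvantage` by design

namespace Summit.QuantumAdvantage.QuantumAdvantage.Theorems.LinnikCubicClassGroups

open _root_.Computability Polynomial
open Literature.Computability.Complexity Literature.Computability.Cryptography
open Literature.Computability.Complexity.Brick Literature.Computability.Complexity.Plumb
open Literature.Computability.Complexity.HashBricks Literature.Computability.Complexity.AdQuery

/-! ### Two small lemmas -/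

/-- Appending entry `i` extends the `i`-prefix to the `(i+1)`-prefix. [folklore] -/
theorem take_append_getD {l : List Bool} {i : ℕ} (h : i < l.length) :
    l.take i ++ [l.getD i false] = l.take (i + 1) := by
  rw [List.take_add_one, List.getElem?_eq_getElem h]
  simp [h]

/-- A Boolean indicator is determined by the membership it indicates. [folklore] -/
theorem boolIndicator_eq_of_iff {L : Set (List Bool)} {s : List Bool} {b : Bool}
    (h : s ∈ L ↔ b = true) : L.boolIndicator s = b := by
  cases b
  · exact (Set.notMem_iff_boolIndicator _ _).1 fun hs => Bool.false_ne_true (h.1 hs)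
  · exact (Set.mem_iff_boolIndicator _ _).1 (h.2 rfl)

/-! ### The post-processor `⟨⟨x, u⟩, y⟩ ↦ [((y ↾ p|x|) ⇂ |u|)₀]` -/

section Post

variable (p : Polynomial ℕ)

/-- The post-processor is polynomial-time computable (composition of the tree's bricks).
[folklore] -/
theorem postFn_mem_FP :
    headBitFn ∘ dropFn ∘ fanoutFn (sndF ∘ fstF) (takeFn ∘ fanoutFn (polyFn p ∘ fstF ∘ fstF) sndF)
      ∈ FP :=
  comp_mem_FP headBitFn_mem_FP (comp_mem_FP dropFn_mem_FP
    (fanoutFn_mem_FP (comp_mem_FP sndF_mem_FP fstF_mem_FP)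
      (comp_mem_FP takeFn_mem_FP (fanoutFn_mem_FP
        (comp_mem_FP (polyFn_mem_FP p) (comp_mem_FP fstF_mem_FP fstF_mem_FP)) sndF_mem_FP))))

/-- Value of the post-processor on a pair `⟨z, y⟩`. [folklore] -/
theorem postFn_boolPair (z y : List Bool) :
    (headBitFn ∘ dropFn ∘ fanoutFn (sndF ∘ fstF) (takeFn ∘ fanoutFn (polyFn p ∘ fstF ∘ fstF) sndF))
        (boolPair z y) =
      [(y.take (p.eval (fstF z).length)).getD (sndF z).length false] := by
  simp [ones]

/-- On a measured string `y` with prefix `f (fstF z)` of length `p(|fstF z|)` the post-processor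
returns bit `|sndF z|` of `f (fstF z)`. [folklore] -/
theorem postFn_boolPair_of_prefix {f : List Bool → List Bool}
    (hlen : ∀ x, (f x).length = p.eval x.length) {z y : List Bool} (hy : f (fstF z) <+: y) :
    (headBitFn ∘ dropFn ∘ fanoutFn (sndF ∘ fstF) (takeFn ∘ fanoutFn (polyFn p ∘ fstF ∘ fstF) sndF))
        (boolPair z y) =
      [(f (fstF z)).getD (sndF z).length false] := by
  rw [postFn_boolPair, ← hlen (fstF z), ← List.prefix_iff_eq_take.1 hy]

end Post

/-! ### The bit language is in `BQP` -/

/-- **The bit language of an `FBQP` function of exactly polynomial length is in `BQP`.**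
`{z | ((f (fstF z)) ⇂ |sndF z|)₀ = 1} ∈ BQP` for `f ∈ FBQP` with `|f x| = p(|x|)`: classical
pre- and post-processing inside bounded-error quantum search (`isQSolvable_classicalWrap_holds`) and
decision from search (`mem_BQP_of_isQSolvable_bit`). [Bernstein–Vazirani 1997, §8; Aaronson 2010,
§1] [folklore] -/
theorem bitLang_mem_BQP {f : List Bool → List Bool} {p : Polynomial ℕ}
    (hlen : ∀ x, (f x).length = p.eval x.length) (hf : f ∈ FBQP) :
    {z : List Bool | (f (fstF z)).getD (sndF z).length false = true} ∈ BQP := by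
  have hsolv : IsQSolvable fun x => {y | f x <+: y} := hf
  have hwrap := isQSolvable_classicalWrap_holds fstF
    (headBitFn ∘ dropFn ∘ fanoutFn (sndF ∘ fstF) (takeFn ∘ fanoutFn (polyFn p ∘ fstF ∘ fstF) sndF))
    fstF_mem_FP (postFn_mem_FP p) hsolv
  have hbit : IsQSolvable fun z =>
      {w | [(f (fstF z)).getD (sndF z).length false] <+: w} := by
    refine hwrap.mono fun z => ?_
    rintro w ⟨y, hy, hw⟩
    rwa [postFn_boolPair_of_prefix p hlen hy] at hw
  exact mem_BQP_of_isQSolvable_bit (fun _ _ => QCircuit.outputPMF_apply_holds)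
    cliffordT_isUnitary_holds (fun z => Iff.rfl) hbit

/-! ### Search from decision: the answer string of the bit queries is `f x` -/

/-- The indicator of the bit language on the query `⟨x, (f x) ↾ i⟩`, `i < |f x|`, is bit `i` of
`f x`. [folklore] -/
theorem boolIndicator_bitLang (f : List Bool → List Bool) (x : List Bool) {i : ℕ}
    (hi : i < (f x).length) :
    {z : List Bool | (f (fstF z)).getD (sndF z).length false = true}.boolIndicator
        (boolPair x ((f x).take i)) = (f x).getD i false := by
  have hl : ((f x).take i).length = i := List.length_take_of_le hi.le
  exact boolIndicator_eq_of_iff (by simp [hl])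

/-- The answer string of the first `i ≤ |f x|` queries `⟨x, answers so far⟩` to the bit language
is the `i`-prefix of `f x`. [folklore] -/
theorem adBits_bitLang (f : List Bool → List Bool) (x : List Bool) {i : ℕ}
    (hi : i ≤ (f x).length) :
    adBits id {z : List Bool | (f (fstF z)).getD (sndF z).length false = true} x i =
      (f x).take i := by
  induction i with
  | zero => simp
  | succ i ih =>
    rw [adBits_succ, ih (Nat.le_of_succ_le hi), id_eq, boolIndicator_bitLang f x hi,
      take_append_getD hi]

/-- With `|f x| = p(|x|)`, the output of the transducer (`G = sndF`: return the answers) is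
`f x`. [folklore] -/
theorem adFn_bitLang {f : List Bool → List Bool} {p : Polynomial ℕ}
    (hlen : ∀ x, (f x).length = p.eval x.length) (x : List Bool) :
    adFn id p sndF {z : List Bool | (f (fstF z)).getD (sndF z).length false = true} x =
      f x := by
  rw [adFn_apply, sndF_boolPair, ← hlen x, adBits_bitLang f x le_rfl, List.take_length]

/-! ### The item -/

/-- **Bitwise search-to-decision** (settles `stmt-QuantumAdvantage-12110`, route
LinnikCubicClassGroups; the same term proves the `rfl`-equal shared item
`DarkClassGroups.SearchToDecision`, stmt-QuantumAdvantage-0235): if `|f x| = p(|x|)` exactly and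
`f ∈ FBQP`, then under `BQP ⊆ BPP` there is a probabilistic polynomial-time algorithm `A` with
`Pr[A(x) = f x] ≥ 2/3` for every `x` — the bit language of `f` is in `BQP ⊆ BPP`
(`bitLang_mem_BQP`), and the pseudo-deterministic simulation of the `p(|x|)` bit queries
(`exists_randAlg_adFn`, error reduction + union bound) reproduces `f x` with probability `≥ 3/4`.
[Aaronson 2010, §1; Bernstein–Vazirani 1997, §8; Arora–Barak 2009, §7.4.1] [folklore] -/
theorem BitwiseSearchToDecision_proof :
    Summit.QuantumAdvantage.QuantumAdvantage.Theses.LinnikCubicClassGroups.BitwiseSearchToDecision := by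
  unfold Summit.QuantumAdvantage.QuantumAdvantage.Theses.LinnikCubicClassGroups.BitwiseSearchToDecision
  rintro f ⟨p, hlen⟩ hf hsub
  have hL := hsub (bitLang_mem_BQP hlen hf)
  obtain ⟨R, hR, -, hpr⟩ := AdBPPSim.exists_randAlg_adFn hL OracleCompose.id_mem_FP sndF_mem_FP p
  refine ⟨R, hR, fun x => ?_⟩
  have h := hpr x
  rw [adFn_bitLang hlen x] at h
  linarith

end Summit.QuantumAdvantage.QuantumAdvantage.Theorems.LinnikCubicClassGroups
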